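import Summits.QuantumFields.YangMills.Theorems.BalabanUVNodesK0RecordFormatNames
import Literature.MathematicalPhysics.QuantumFieldTheory.Balaban1983to89.B6SectAWholeTorusBridge

/-!
# K0⁷ — THE RECORD-SIDE FORMAT NAMES, EDITION 14 = Q-12 REPAIR (ρ1), variant (L): THE RESPONSE RE-GAUGED TO PRINT's (21)-LANDAU REPRESENTATIVE —
# the `…L` names `recordD ∕ landauPot ∕ landauRep ∕ landauRepC ∕ recordHr ∕ recordGkL ∕ recordResponse9DataFromL ∕ Response9DAtL`, and the displayed
# invariance receipt `ChartGaugeInvariantAtJ`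

Cell `ym-nodeO-ideate` ∕ `ym-balaban-port`, DEFINER seat `ym-nodeO-def-1` (gen 34), on CRIT-1 g33's RULING Q-12 «ROOTED-GAUGE DEFECT» (nodeO STATUS 2026-08-31T01:11:41Z,
UPHELD: 27931's consequent row (R1ᴰ) demands (4.4)-scaled decay of the response `recordGkJ` READ IN THE ROOTED GAUGE `recordBgField := UkSel …`, where the
bond below every block centre carries a full Polyakov-cycle response — porter PT-B-1 g2, `ROOTED-GAUGE-DEFECT-27931.md` 2177878dc3bab4c7, kernel p799787;
print's decay statements are about the LANDAU ∕ localized representative: [15] (21) p.281 «R(U₀)D^{η*}_{U₀}A = 0», (190) p.308; [I] (4.2) p.281, (4.35) p.290),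
REPAIR (ρ1) variant (L) as ruled: «the LINEAR (21)-Landau representative of the response (`recordHrJ y := D_y − d(φ_y)` with `φ_y` the solution of the (21)-LR
normalisation — finite-torus linear algebra …; at linear order Landau fixing IS a linear projection) with `recordResponse9DataFromL` (`Gk := recordHrJ`-coordinates,
𝐉-block unchanged)», plus the receipt `ChartGaugeInvariantAtJ`.  Variant (H) (print's localized `H(□₀, B)` of (3.37)∕(4.35), curing (R4ᴰ) too) is the LATER edition.
`--kind definition --supports stmt-QuantumFields-20541 --as helper`; count-neutral.  [I] = [Balaban1987RG1], [15] = [Balaban1985Variational],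
[B6] = [Balaban1984PropagatorsII], [B5] = [Balaban1984PropagatorsI].

THE LANDAU NORMALISATION IS THE TREE's (no new analysis here): for a real bond field `x ∈ ℓ²(bonds of T_K)` and the `(k+1)`-fold block averaging of the record,
[B6] (2.12) p.225 «exactly one minimum on each orbit» is IN KERNEL as `B6SectAWholeTorusBridge.existsUnique_landauGauge`:
`∃! n : ScalarSpace (F.P K), siteAvgIter (k+1) n = 0 ∧ x − gradV1 (F.P K) c n ∈ B5Eq164LandauV1.lan (F.P K) (k+1) c s` — the UNIQUE gauge potential `n` with vanishing
iterated block averages (print's `N(Q′_{k+1})`, [B5] p.25) carrying `x` into the Landau subspace `{R∂*A = 0}` of [B5] (1.47) ([15] (21) at the flat background, `R` = the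
orthogonal projection onto `ΔN(Q′)`).  `landauPot` is THAT `n` (a definite description: `∃!`-unique, hence selection-FREE — no arbitrary choice, no junk on the standing range
`k + 1 ≤ m + K`; off range `0`), at the plain-lattice weights `c = s = 1`; `landauRep x := x − grad n`.  Complex ∕ matrix-valued responses are re-gauged ENTRYWISE on real and
imaginary parts (`landauRepC`), which is the ℝ-linear extension.

WHAT THIS FILE IS (definitions only; statement-form; NEW names, §1–§21 untouched — append-only rule):
* §22a `recordD F θ k K a l` — the ROOTED response entries `D_y(b)_{ii'} = ∂_B|₀ (U_{k+1}(W_B)(b))_{ii'}[δ_{y,a}]` (the `D` of TokP9-reg ∕ TokP9L, verbatim shape).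
* §22b `landauPot ∕ landauRep ∕ landauRepC` — the (21)-Landau normalisation of a bond field (tree theorem above), and its entrywise complexification.
* §22c `recordHr F θ k K a l := landauRepC ∘ recordD` entrywise — print's `Hr` (TokP9L's `∃ Hr φ, D = Hr + dφ ∧ Landau(Hr)` is now a NAME with `φ := landauPot`);
  `recordGkL` — the two-block response coordinates with the 𝐔-block READ FROM `recordHr` and the 𝐉-block UNCHANGED (`J` is gauge-COVARIANT and `J(1) = 0`, so its
  linearisation is gauge-independent — PTB-1 §4); `recordResponse9DataL ∕ recordResponse9DataFromL` — typer-1's `Response9Data` at the record with `Gk := recordGkL`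
  (every other field = the `…J` data); receipt `Response9DAtL` (27931 ⁷‴'s consequent (C1) body-to-be).
* §22d receipt `ChartGaugeInvariantAtJ` — the pieces `E n X` composed with the record chart are invariant under RESIDUAL `SL(2,ℂ)`-valued LATTICE gauge transformations acting
  on coordinates by `recordAct` (print (4.2)∕(4.7) «E(V^u) = E(V)», site-dependent `u` — the (1.19) vehicle `recordAdJ` covers CONSTANT rotations only).
The faces (ℝ-linearity of `landauPot ∕ landauRep` from uniqueness; `recordD = recordHr + d(landauPot)` entrywise; `recordHr ∈ lan` entrywise; `recordGkL`'s 𝐉-block = `recordGkJ`'s)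
are lemma-file material (lemma file 9), not here.

HONEST FRAMING.  Definitions only; NOTHING of Bałaban is asserted, ported or discharged; 27931's (C1) AS SIGNED (⁶…⁷″-LR4) is MISSTATED (Q-12) and stays NEVER-CLOSE-AGAINST until
⁷‴ is cut over these names by the typer and signed by CRIT-1; 27930⁸∕26648 LR4 SIGNED·OPEN; K0⁷∕K-Ax OPEN; NODE O not inhabited (0∕1); COUNT 8∕28 · K 1∕4 UNMOVED; finite
`𝕋⁴_{L^K}` at fixed ε — NOT continuum ∕ ℝ⁴ ∕ OS; **the Yang–Mills mass gap (Clay) is NOT proved by any of this.**  No `sorry`, `instance`, `notation`; standard axioms.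
-/

noncomputable section

open scoped BigOperators Matrix.Norms.L2Operator

namespace Summit.QuantumFields.YangMills.Theorems.K0RecordFormatNames

open Literature.MathematicalPhysics.QuantumFieldTheory.Balaban1983to89
open Literature.MathematicalPhysics.QuantumFieldTheory.Balaban1983to89.Node00
open Literature.MathematicalPhysics.QuantumFieldTheory.Balaban1983to89.T4Continuum (T4Family)
open Literature.MathematicalPhysics.QuantumFieldTheory.BalabanImbrieJaffe1984to88.BIJ85AxialPropagator411 (BondSpace)
open Literature.MathematicalPhysics.QuantumFieldTheory.Balaban1983to89.B6SectAOperatorsV1 (ScalarSpace)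
open Literature.MathematicalPhysics.QuantumFieldTheory.BalabanImbrieJaffe1984to88.BIJ85LandauMinimizer442V1 (gradV1)

variable (F : T4Family)

/-! ## §22a  The ROOTED response entries `D` (TokP9-reg's object, by name) -/

section Rooted

variable (θ : Stage13Params F 2)

/-- **`D` — `recordD F θ k K a l b i i'`**: the derivative at `B = 0`, in the direction of the basis field `δ_{l} ⊗ bV a`, of the `(i, i')` matrix entry of the ROOTED-gauge
background field `U_{k+1}(W_B)(b)` (`recordBgField`) — the `D` the TokP9-reg ∕ TokP9L tokens of the signed port texts quantify (their `letI D := fderiv ℝ (…) 0 (Pi.single …)`,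
verbatim shape). [cite: Balaban1985Variational, Prop. 9 p.309, (190) p.308; Balaban1987RG1, (4.35) p.290] -/
def recordD (k K : ℕ) (a : θ.ιβ) (l : RespLabel F k K) : PBond (F.P K) 0 → Fin 2 → Fin 2 → ℂ :=
  letI := θ.instVβ₁; letI := θ.instVβ₂; letI := θ.instιβ
  fderiv ℝ (fun B : Fin (F.P K).d → Site (F.P K) (k + 1) → θ.Vβ =>
    fun (b : PBond (F.P K) 0) (i i' : Fin 2) => ((recordBgField F θ k K B b : SU 2) : Matrix (Fin 2) (Fin 2) ℂ) i i') 0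
    (Pi.single l.1 (Pi.single l.2 (θ.bV a)))

end Rooted

/-! ## §22b  The (21)-Landau normalisation of a bond field (tree: [B6] (2.12) «exactly one minimum on each orbit») -/

/-- **The (21)-LANDAU GAUGE POTENTIAL of a real bond field** on the fine lattice of `T_K` for the `(k+1)`-fold block averaging: THE unique `n ∈ ℓ²(sites)` with vanishing
iterated block averages `siteAvgIter (k+1) n = 0` (print's `N(Q′)`) such that `x − grad n` lies in the Landau subspace `{R∂*A = 0}` (`B5Eq164LandauV1.lan`, weights `c = s = 1`)
— `B6SectAWholeTorusBridge.existsUnique_landauGauge` ([B6] (2.12) p.225), a definite description (unique ⇒ selection-free); `0` off the standing range `k + 1 ≤ m + K`.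
[cite: Balaban1984PropagatorsII, (2.10)–(2.12) p.225; Balaban1984PropagatorsI, (1.47) p.26; Balaban1985Variational, (21) p.281] -/
def landauPot (k K : ℕ) (x : BondSpace (F.P K)) : ScalarSpace (F.P K) :=
  if h : k + 1 ≤ (F.P K).m + (F.P K).K then
    (B6SectAWholeTorusBridge.existsUnique_landauGauge (P := F.P K) (k := k + 1) h (c := (1 : ℝ)) (s := (1 : ℝ)) one_ne_zero one_ne_zero x).exists.choose
  else 0

/-- **The (21)-LANDAU REPRESENTATIVE of a real bond field**: `x − grad (landauPot x)` — the element of the orbit `{x − ∂λ : Q′λ = 0}` in the Landau subspace.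
[cite: Balaban1984PropagatorsII, (2.12) p.225; Balaban1985Variational, (21) p.281] -/
def landauRep (k K : ℕ) (x : BondSpace (F.P K)) : BondSpace (F.P K) :=
  x - gradV1 (F.P K) 1 (landauPot F k K x)

/-- Real part of a complex bond function, as an element of `ℓ²(bonds)`. [cite: Balaban1985Variational, (21) p.281 (bookkeeping)] -/
def reBond (K : ℕ) (x : PBond (F.P K) 0 → ℂ) : BondSpace (F.P K) := WithLp.toLp 2 fun b => (x b).re

/-- Imaginary part of a complex bond function, as an element of `ℓ²(bonds)`. [cite: Balaban1985Variational, (21) p.281 (bookkeeping)] -/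
def imBond (K : ℕ) (x : PBond (F.P K) 0 → ℂ) : BondSpace (F.P K) := WithLp.toLp 2 fun b => (x b).im

/-- **The Landau representative of a COMPLEX bond function** (the ℝ-linear extension: real and imaginary parts re-gauged separately).
[cite: Balaban1985Variational, (21) p.281; Balaban1984PropagatorsII, (2.12) p.225] -/
def landauRepC (k K : ℕ) (x : PBond (F.P K) 0 → ℂ) : PBond (F.P K) 0 → ℂ :=
  fun b => ((WithLp.ofLp (landauRep F k K (reBond F K x)) b : ℝ) : ℂ) + ((WithLp.ofLp (landauRep F k K (imBond F K x)) b : ℝ) : ℂ) * Complex.I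

/-- The complex gauge potential of a complex bond function (entrywise `landauPot`). [cite: Balaban1985Variational, (21) p.281 (bookkeeping)] -/
def landauPotC (k K : ℕ) (x : PBond (F.P K) 0 → ℂ) : Site (F.P K) 0 → ℂ :=
  fun y => ((WithLp.ofLp (landauPot F k K (reBond F K x)) y : ℝ) : ℂ) + ((WithLp.ofLp (landauPot F k K (imBond F K x)) y : ℝ) : ℂ) * Complex.I

/-! ## §22c  `Hr`, the re-gauged two-block response, and the response data ∕ receipt of the L-layer -/

section Landau

variable (θ : Stage13Params F 2)

/-- **`Hr` — `recordHr F θ k K a l b i i'`**: the (21)-LANDAU REPRESENTATIVE of the rooted response `D`, matrix entry by matrix entry — print's `δℋ∕δB` of [15] Prop. 9 ∕ (190)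
(the `Hr` of TokP9L with `φ := landauPotC ∘ recordD`, now a NAME). [cite: Balaban1985Variational, Prop. 9 p.309, (190) p.308, (21) p.281; Balaban1987RG1, (4.35) p.290] -/
def recordHr (k K : ℕ) (a : θ.ιβ) (l : RespLabel F k K) : PBond (F.P K) 0 → Fin 2 → Fin 2 → ℂ :=
  fun b i i' => landauRepC F k K (fun b' => recordD F θ k K a l b' i i') b

/-- **`G_k` RE-GAUGED — `recordGkL F θ k K a l`**: the two-block response coordinates with the `𝐔`-block read from `Hr` (𝔰𝔩₂-coordinates of the matrix `(recordHr … b)`) and the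
`𝐉`-block UNCHANGED (`recordGkJ`'s: the current `J` is gauge-covariant with `J(1) = 0`, so its linearisation does not see the gauge). [cite: Balaban1987RG1, (4.35) p.290, (1.8)–(1.9) p.261; Balaban1985Variational, Prop. 9 p.309] -/
def recordGkL (k K : ℕ) (a : θ.ιβ) (l : RespLabel F k K) (i : Fin (recordChartDimJ F K)) : ℂ :=
  Sum.elim
    (fun c => sl2Coord (Matrix.of fun i₁ i₂ => recordHr F θ k K a l ((chartEquivJ F K).symm i).1 i₁ i₂) c)
    (fun _ => recordGkJ F θ k K a l i)
    ((chartEquivJ F K).symm i).2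

/-- **The L-layer response data** (unshifted): typer-1's `Response9Data` at the record with `Gk := recordGkL`, every other field as in `recordResponse9DataJ`.
[cite: Balaban1985Variational, Prop. 9 p.309; Balaban1987RG1, (4.35) p.290] -/
def recordResponse9DataL (a : θ.ιβ) (Mc k : ℕ) :
    B12FormatPlus.Response9Data (recordDomSys F Mc k) (recordBondCount F) (recordChartDimJ F) 4 where
  Cc := recordCc F Mc k
  Λ := RespLabel F k
  G := recordSiteGeom F Mc k
  ρ := recordRho F k
  e := recordE F k
  cX := recordCXJ F Mc k
  siteOf := fun K => recordSiteOfJ F k K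
  Gk := fun K => recordGkL F θ k K a
  wrap := recordWrapCtr F Mc k
  emb := recordDomEmbCtr F Mc k
  jX := fun K _ => recordJXJ F K
  πc := fun K _ => recordCoordProjCtr F K

/-- **The L-layer response data from the base volume `K₀`** (member `n` = volume `K₀ + n`): `recordResponse9DataFromJ` with `Gk := recordGkL`.
[cite: Balaban1985Variational, Prop. 9 p.309; Balaban1987RG1, (1.21) p.264] -/
def recordResponse9DataFromL (a : θ.ιβ) (Mc k K₀ : ℕ) :
    B12FormatPlus.Response9Data (fun n => recordDomSys F Mc k (K₀ + n)) (fun n => recordBondCount F (K₀ + n)) (fun n => recordChartDimJ F (K₀ + n)) 4 where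
  Cc := fun n => recordCc F Mc k (K₀ + n)
  Λ := fun n => RespLabel F k (K₀ + n)
  G := fun n => recordSiteGeom F Mc k (K₀ + n)
  ρ := fun n => recordRho F k (K₀ + n)
  e := fun n => recordE F k (K₀ + n)
  cX := fun n => recordCXJ F Mc k (K₀ + n)
  siteOf := fun n => recordSiteOfJ F k (K₀ + n)
  Gk := fun n => recordGkL F θ k (K₀ + n) a
  wrap := fun n => recordWrapCtr F Mc k (K₀ + n)
  emb := fun n => recordDomEmbCtr F Mc k (K₀ + n)
  jX := fun n _ => recordJXJ F (K₀ + n)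
  πc := fun n _ => recordCoordProjCtr F (K₀ + n)

/-- **RECEIPT (L): 27931 ⁷‴'s response half** — typer-1's `Response9D` in the gauge norm of the two-block (4.4) domain, CENTRED layer, window radius `recordRNat`, from the base
volume `K₀`, with the response READ IN THE (21)-LANDAU GAUGE (`recordResponse9DataFromL`).  Prop-valued; asserts nothing. [cite: Balaban1985Variational, Prop. 9 p.309, (21) p.281; Balaban1987RG1, (4.4) p.281, (1.21) p.264] -/
def Response9DAtL (a : θ.ιβ) (Mc k K₀ : ℕ) (α₂ C₉ δ₀ : ℝ) : Prop :=
  B12FormatPlus.Response9D (recordResponse9DataFromL F θ a Mc k K₀) (fun n => recordChartJ F Mc k (K₀ + n)) (fun n => recordRNat F Mc k (K₀ + n))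
    (fun n X => recordDom44J F Mc k (K₀ + n) X α₂) C₉ δ₀

end Landau

/-! ## §22d  RECEIPT: chart-level invariance under RESIDUAL lattice gauge transformations (print (4.2)∕(4.7) «E(V^u) = E(V)») -/

/-- **A RESIDUAL `SL(2,ℂ)`-valued lattice gauge transformation** of the fine lattice of `T_K` at level `k + 1`: `u(x) = 1` at every embedded site of the `(k+1)`-lattice (the
tree's `IsResidual` convention of `B12GaugeOrbits021`: «u = 1 at the embedded sites, free elsewhere»). [cite: Balaban1987RG1, (1.10) p.262, (2.3) p.265; Balaban1985Variational, (19) p.281] -/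
def IsResidualGc (k K : ℕ) (u : recordGaugeGrp F K) : Prop :=
  ∀ y : Site (F.P K) (k + 1), u.1 (B15DeterminingSets.embIter (k + 1) y) = 1

/-- **RECEIPT `ChartGaugeInvariantAtJ`**: the piece family `E n X` (on coordinates of pairs at volume `K₀ + n`) is invariant under every RESIDUAL `SL(2,ℂ)`-valued lattice gauge
transformation acting by the site-dependent (1.10) action `recordAct` — print's «E(V^u) = E(V)» ((4.2)∕(4.7)) at the record names, DISPLAYED (the (1.19) vehicle `recordAdJ` of the
signed texts covers CONSTANT rotations only).  With it a consumer may move between the rooted response `D` and `Hr` inside `E` at second order.  Prop-valued; asserts nothing.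
[cite: Balaban1987RG1, (4.2) p.281, (4.7) p.283, (1.19) p.263, (1.10) p.262] -/
def ChartGaugeInvariantAtJ (Mc k K₀ : ℕ) (E : (n : ℕ) → (recordDomSys F Mc k (K₀ + n)).Dom → (Fin (recordBondCount F (K₀ + n)) → ℂ) → ℂ) : Prop :=
  ∀ n (X : (recordDomSys F Mc k (K₀ + n)).Dom) (u : recordGaugeGrp F (K₀ + n)), IsResidualGc F k (K₀ + n) u →
    ∀ c : Fin (recordBondCount F (K₀ + n)) → ℂ, E n X (recordAct F (K₀ + n) u c) = E n X c

end Summit.QuantumFields.YangMills.Theorems.K0RecordFormatNames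

end
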